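import Mathlib
import Literature.Analysis.FluidPDE.VectorCalculus
import Literature.Analysis.FluidPDE.ClassicalSolution
import Literature.Analysis.FluidPDE.AxisymmetricEuler
import Literature.Analysis.FluidPDE.SverakLandauClassification
import Summits.NavierStokesRegularity.NavierStokesRegularity.Theses.ThreadingFlux
import Summits.NavierStokesRegularity.NavierStokesRegularity.Theorems.ThreadingFluxCentreJetDefs
import HarnessLib

/-!
# Crux `PoloidalLiouville` (stmt-NavierStokesRegularity-1222, wall W1 = `stub_scalarLiouville`), crux idea «azimuthal-cartan-test»
# (ns-idea-15 g10, lens «negation»; v1.3c): WHERE CAN A NON-AXISYMMETRIC UNTHREADED STEADY FLOW COME FROM?  A Cartan-type jet count.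

NS regularity is NOT proved here; `PoloidalLiouville` (1222) stays OPEN; nothing in this file is an NS-regularity statement.
This is a TYPED SKETCH (objects + conjectures + two pure-logic glue lemmas, 0 `sorry`), the Lean face of the computation
reported in `AzimuthalCartanResults.md` (engine `cartan_mode.py`, `indicial.py`; exact rational arithmetic).

## The lever (negation lens)
To BUILD a counterexample to 1222 one needs, at the very least, a non-axisymmetric steady (or time-harmonic) Navier–Stokes germ whose
vortex lines lie on the spheres about a centre `x₀` ("unthreaded", `⟪x − x₀, curl v⟫ = 0`).  Every constructive programme on this wall
(centre jets, far-field towers, bifurcation from the axisymmetric family) starts from an axisymmetric no-swirl flow and deforms it.  We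
computed the space of FORMAL deformations: at a regular point `x₁` (off the axis, `curl V (x₁) ≠ 0`) of an axisymmetric no-swirl steady
base `V`, decompose a perturbation into azimuthal Fourier modes `k` about the axis through `x₀`; the linearised system
{steady NS at `V`} + {`div = 0`} + {`⟪x − x₀, curl δv⟫ = 0`} is a linear PDE system in the two meridional variables, and the dimension
`h_k(D′)` of its `D′`-jets of formal solutions at `x₁` is computable exactly (one elimination; stable range checked to `D = 14`).

## Result (9 random Cauchy–Kovalevskaya bases at 3 points, and the Landau solution; all exact)
* `k = 0`: `h = 4D′ + 5` — the axisymmetric no-swirl family itself (4 functions of one variable) + the potential swirl `κ/ρ`.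
* `k = 1`: `h = 1` at every order — the infinitesimal TILT of the axis about `x₀`, and nothing else.
* `k = 2,3,4,5`: `h = 0` — NO formal solution whatsoever.  Same for time-separated perturbations `e^{σt} δv`, `σ ∈ {±1, 7/3, −2, 3}`
  (then already `h = 0` at `k = 1`).
* THE ONE EXCEPTION: base (−1)-HOMOGENEOUS about the centre (Landau flow, `x₀` = its vertex): `h = 6` for every `k = 1..5`; the scaling
  generator acts on these 6 with characteristic polynomial `μ⁴(μ+1)²`, diagonalisably: per mode four perturbations homogeneous of
  degree −1 and two of degree −2.  (Four per mode is the non-axisymmetric twin of the Li–Li–Yan count: the axisymmetric no-swirl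
  (−1)-homogeneous solutions on `S² ∖ {N,S}` form a 4-dimensional family, arXiv:1704.08730, p. 3.)

## What this says (information-grade; the typed statements below)
(N1) `InfinitesimalRigidityOffCentre` (conjecture I♭, computed evidence): off a scaling vertex, the unthreaded steady system admits no
     non-axisymmetric infinitesimal deformation at all — counterexamples to 1222's steady stratum are FORMALLY ISOLATED from the
     axisymmetric family; no bifurcation / implicit-function / centre-jet-continuation construction can start there (this is the
     negation lens's no-go, and it is new guidance for W1's `stub_scalarLiouville`: the obstruction to `∇T × (x − x₀) = 0` is not local).
(N2) `LandauVertexFlexibility` (V♯, computed): the non-degeneracy clause of I♭ is NECESSARY — at the vertex of a homogeneous base the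
     same system has 6 solutions per mode (`landau_vertex_is_degenerate`: I♭ ∧ V♯ ⇒ the Landau germ is (−1)-homogeneous about 0, which
     it is).  The surviving local freedom is exactly scale-invariant: it matches the centre strata of «steady-centre-sieve» (g5) and the
     Type-I residual of «typei-farpast-collapse» (ns-idea-14) — three independent levers now point at self-similar profiles about `x₀`.
(N3) `PoloidalConicalFlows` (K♯, essentially IN PRINT — Šverák's conformal correspondence with a non-Möbius meromorphic `f`, survey
     arXiv:2509.07243 §2.1.3): non-axisymmetric (−1)-homogeneous steady flows on open cones, unthreaded about the vertex, EXIST; the count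
     re-detects them as the vertex flexibility (4 per mode of degree −1 ⊇ the 2-per-mode linearised Liouville class).  They refute the
     UNRESTRICTED local rigidity statement (`conicalFlows_refute_unrestricted`): regularity AT THE CENTRE (as in g5's `SteadyLocalRigidity`,
     ball about `x₀`) or boundedness is what any rigidity theorem for unthreaded flows must use — a tightness statement for W1/W2 with
     NON-axisymmetric witnesses (the wall's boundedness-tightness so far used the axisymmetric Landau flow only).
(P)  `SteadyShellRigidity` (C♯): the nonlinear semi-local statement the count supports (v1.2: the ball statement C♭ is demoted);
     `ShellReduction` (R♯, open, paper-sketched in its docstring) carries C♯ to the steady stratum `SteadyUnthreadedLiouville'` of 1222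
     (verbatim twin of `CentreJetSketch.SteadyUnthreadedLiouville`, l.356).

## v1.2 (answers critic verdict V26, prices P1–P5)
(P1, THE REAL GAP — now a typed NEGATIVE FACT) On a BALL off the axis the azimuth `φ` is a single-valued coordinate and an analytic `δv`
need not be `2π`-periodic.  The engine's new Jordan-chain test (`cartan_ext.py`, `JOB_EXT=jordan|forced`) finds, at `k = 0`, exactly ONE
extra formal solution LINEAR IN `φ` at every order (generic bases and Landau off-vertex): `δv = φ · e_φ/ρ + u₀(ρ,z) = ∇(φ²/2) + u₀`, the
potential-swirl mode times `φ` plus an axisymmetric poloidal correction `u₀` solving a DETERMINED forced system (Cauchy–Kovalevskaya).  It is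
unthreaded (`curl ∇(φ²/2) = 0`, `u₀` poloidal), solves the linearised equations, and is not a tilt plus an equivariant field.  HENCE THE
BALL VERSION OF I♭ IS FALSE: `InfinitesimalRigidityOffCentreBall` is kept for the record and refuted by the typed witness statement
`LandauBallJordanMode` (J♭, provable, M) through the kernel glue `ballRigidity_refuted`.  I♭ is RE-TYPED on ROTATION-INVARIANT solid tori
`solidTorus x₀ a c ε` about the base axis (analytic ⇒ `2π`-periodic ⇒ integer modes, no `φ`-polynomials); no chain at `k = ±1`
(`h_pairs = h_M`), and the mode parameter scanned off the integers — `k ∈ {1/2, 3/2, 7/2, i, 2i, 1+i, (1+i)/2, 2+3i}` all give `h = 0` — so on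
the sampled bases the exceptional set of the complexified mode parameter is `{0, ±1}` as far as tested (critic's independent reruns: also
`k = 1/2, 3/2` and hyperbolic `λ = 1/2, 1, 2, 3`).  The nonlinear ball statement C♭ is exposed to the same sector (its nonlinear status is
open) and is DEMOTED: no longer in the chain, which is now C♯ (shells are rotation-invariant about every axis through `x₀`) → R♯ → steady
stratum (`steadyStratum_of_shell`).
(P2) "formal ⇒ analytic" is meant PER MODE on a torus: for `k ∉ {0, ±1}` the formal space is `0`, so an analytic mode with that `k`
vanishes identically (no convergence issue at all); `k = ±1` gives the tilt jet, `k = 0` is equivariant by definition.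
(P3) Nearest published neighbour of the VERTEX sector (V♯): Shtern–Hussain, *Azimuthal instability of divergent flows*, JFM 256 (1993)
535–560, doi:10.1017/s0022112093002873, and *Instabilities of conical flows causing steady bifurcations*, JFM 366 (1998),
doi:10.1017/s002211209800891x — per-azimuthal-wavenumber STEADY symmetry breaking of conically similar flows (Landau/Squire jets) as an ODE
eigenproblem in the polar angle with regularity imposed on the whole sphere (bifurcation at critical Reynolds numbers).  V♯ lives in their
setting WITHOUT boundary conditions on the sphere and WITH the unthreaded constraint; I♭ (off-vertex, constrained) has no counterpart there.
(P4) K♯: IN PRINT is only the EXISTENCE of non-axisymmetric local (−1)-homogeneous steady flows with gradient tangential part (Šverák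
arXiv:math/0604550 §4; survey arXiv:2509.07243 §2.1.3); `curl ≢ 0` and non-equivariance about EVERY axis for `f = e^{bz}` are this card's
COMPUTATION (double precision), to be PROVED from the explicit field — a Literature fact may quote only the printed sentence.
(P5) Booking words for (N1): no construction BY ANALYTIC DEFORMATION THROUGH THE AXISYMMETRIC NO-SWIRL FAMILY off a scaling vertex —
formally, linearised, at sampled bases, on rotation-invariant neighbourhoods; an exotic component of the nonlinear jet variety is untouched.
W1 movement 0; information-grade.

## v1.3 (same session): THE φ-POLYNOMIAL SECTOR INTEGRATES — explicit non-axisymmetric unthreaded steady flows on balls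
(J♭ made ELEMENTARY) At the Hagen–Poiseuille base `V = −ρ² e₃`, `p = −4z` (admissible: analytic, steady NS, axisymmetric about `e₃` through
`0`, no swirl, `curl V = (−2y, 2x, 0) ≠ 0`, not (−1)-homogeneous about `0`) the `φ`-linear mode is in CLOSED FORM:
`δv = (φ/ρ) e_φ − (log ρ/ρ) e_ρ + (ρ²/2)(log ρ − 1) e₃`, `δp = 0` (`jordanMode`; certified by `engine/jordan_check.py`: linearised residual ≤ 5e-16,
`div`, `x·curl` ≤ 3e-16, Lie derivative along the rotation = `e_φ/ρ` exactly).  So `PoiseuilleJordanMode` (J♭, S–M: explicit calculus, no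
Cauchy–Kovalevskaya) refutes `InfinitesimalRigidityOffCentreBall` (`ballRigidity_refuted`).
(K♭, NEW EXACT FAMILY — the nonlinear ball statement C♭ is FALSE) `u_γ = ∇Χ_γ + G_γ(ρ) e₃`, `Χ_γ = γ(φ² − (log ρ)²)` (planar harmonic),
`G_γ′(ρ) = ρ⁻¹ e^{−γ (log ρ)²}`, `p = −|u|²/2 + G_γ²/2`: an exact steady NS flow on every simply connected region off the axis (CLASS in print:
potential cross flow + axial profile solving the linear advection–diffusion equation `Δ₂G = ∇Χ·∇G − c`, Weinbaum–O'Brien, Phys. Fluids 10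
(1967) 1438, doi:10.1063/1.1762303; Wang, Annu. Rev. Fluid Mech. 23 (1991), doi:10.1146/annurev.fl.23.010191.001111 — this MEMBER and its use
are ours: `∂_ρΧ` radial forces `Χ = γ(φ² − log²ρ) + βφ + α log ρ`, and `G` radial ⇔ `curl u = −G′ e_φ` ⇔ UNTHREADED about every point of the
axis).  For `γ ≠ 0` it has `curl ≢ 0`, is not (−1)-homogeneous, and is NOT infinitesimally axisymmetric about any axis through `0`
(`L_{e₃} u = 2γ e_φ/ρ ≠ 0`; any other axis would make the azimuthal vorticity `SO(3)`-invariant, hence zero).  Certified by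
`engine/crossflow_check.py` (`γ = 0.5, 2`: NS residual ≤ 1e-16 against nonlinear terms ≈ 0.1, `x·curl u` ≤ 2e-16, equivariance defect
`0.107 / 0.507`; control `γ = 0`: defect `0.000`).  Typed: `SectorialCrossFlows` (K♭) and kernel glue `crossFlows_refute_ballRigidity :
K♭ → ¬C♭` (and `¬C♭₀`).  READING for W1/W2: besides regularity at `x₀`/boundedness (K♯), the AZIMUTHAL PERIODICITY of the domain is
load-bearing — local rigidity of unthreaded steady flows is false on balls and can only hold on domains wrapping the axis (I♭ on solid tori,
C♯ on shells); globally on `ℝ³` both `φ` and `log ρ` are forbidden, which is consistent with 1222.  None of these flows is bounded on `ℝ³`.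

SAME-WALL: W1 ⟨1222⟩ (steady / time-harmonic strata; guidance for `stub_scalarLiouville`) and W2 ⟨27585⟩ (`stub_shearedRigidity`: I♭ is
its linearisation at the axisymmetric locus and HOLDS formally off the vertex; K♯ says a local version of 27585 without regularity at
`x₀` should FAIL).  W3 ⟨26991⟩ untouched.
-/

-- the summit and its single sub-problem share the name (CONVENTIONS §1)
set_option linter.dupNamespace false

noncomputable section

namespace Summit.NavierStokesRegularity.NavierStokesRegularity.Cruxes.PoloidalLiouville.AzimuthalCartan

open Set Function Metric
open Literature.Analysis.FluidPDE (cross curl crossCLM swirl landauAxisField landauAxisPressure Sverak2011_landauClassification)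
open Summit.NavierStokesRegularity.NavierStokesRegularity.Theorems.PoloidalLiouville.CentreJet
  (E3 IsUnthreadedAbout IsSteadyNSOn)

/-! ## Objects -/

/-- `W` is unthreaded about `x₀` ON `U`: `⟪x − x₀, curl W x⟫ = 0` for `x ∈ U` (1222's hypothesis, localised; linear in `W`, so it is
also the linearised constraint). -/
def IsUnthreadedOn (U : Set E3) (x₀ : E3) (W : E3 → E3) : Prop :=
  ∀ x ∈ U, inner ℝ (x - x₀) (curl W x) = 0

/-- `V` is homogeneous of degree `−1` about `x₀` on `U` (Euler identity `DV(x)(x − x₀) = −V(x)`; for analytic `V` on a connected `U`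
this is homogeneity on the cone through `U`).  The DEGENERACY excluded by I♭/C♭ and realised by the Landau flow about its vertex. -/
def IsMinusOneHomogeneousOn (U : Set E3) (x₀ : E3) (V : E3 → E3) : Prop :=
  ∀ x ∈ U, fderiv ℝ V x (x - x₀) = -(V x)

/-- A non-zero skew endomorphism of `ℝ³` = an infinitesimal rotation `A y = a × y` about the axis `ℝa` (`a ≠ 0`); same shape as the
conclusion of `UnthreadedRigidityDoor.UnthreadedRigidity` (stmt-27585). -/
def IsSkewAxis (A : E3 →L[ℝ] E3) : Prop :=
  (∀ x : E3, inner ℝ (A x) x = 0) ∧ A ≠ 0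

/-- Infinitesimal rotational equivariance of `W` on `U` about the axis of `A` through `x₀`: the Lie derivative of `W` along the
rotation field `x ↦ A (x − x₀)` vanishes, `DW(x)(A(x − x₀)) = A (W x)` (27585's conclusion, localised to `U`). -/
def IsEquivariantOn (U : Set E3) (x₀ : E3) (A : E3 →L[ℝ] E3) (W : E3 → E3) : Prop :=
  ∀ x ∈ U, fderiv ℝ W x (A (x - x₀)) = A (W x)

/-- The swirl of `W` about the axis of `A` through `x₀`, `⟪W x, A (x − x₀)⟫ = ρ W_φ`, is CONSTANT on `U` (value `κ`: the potential
vortex `κ/ρ e_φ`, the only swirl the unthreaded constraint allows at mode `k = 0`; `κ = 0` = no swirl). -/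
def HasConstantSwirlOn (U : Set E3) (x₀ : E3) (A : E3 →L[ℝ] E3) (W : E3 → E3) : Prop :=
  ∃ κ : ℝ, ∀ x ∈ U, inner ℝ (W x) (A (x - x₀)) = κ

/-- Linearised steady Navier–Stokes at the base `V` on `U` (`ν = 1`): `div δv = 0`, `(V·∇)δv + (δv·∇)V + ∇δp = Δ δv`. -/
def LinearisedSteadyNSOn (U : Set E3) (V δv : E3 → E3) (δp : E3 → ℝ) : Prop :=
  (∀ x ∈ U, Literature.Analysis.FluidPDE.VectorCalculus.divergence δv x = 0) ∧
    ∀ x ∈ U, fderiv ℝ δv x (V x) + fderiv ℝ V x (δv x) + gradient δp x = Laplacian.laplacian δv x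

/-- The infinitesimal TILT of `V` about `x₀` with angular velocity `Ω`: `d/dθ|₀` of `R_θ V (R_θ⁻¹ ·)` (rotations about the axis `ℝΩ`
through `x₀`), `tilt V x₀ Ω x = Ω × V x − DV(x)(Ω × (x − x₀))`.  For an axisymmetric base and `Ω ⊥` axis this is the unique `k = 1`
solution found by the count (verified exactly in the engine). -/
def tilt (V : E3 → E3) (x₀ Ω : E3) : E3 → E3 :=
  fun x => cross Ω (V x) - fderiv ℝ V x (cross Ω (x - x₀))

/-- The open spherical shell `r₁ < |x − x₀| < r₂` (rotation-invariant about every axis through `x₀`; avoids the centre). -/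
def shell (x₀ : E3) (r₁ r₂ : ℝ) : Set E3 :=
  {x | r₁ < dist x x₀ ∧ dist x x₀ < r₂}

/-- The Landau solution with parameter `2`, axis `e₂`, vertex `0` — BY NAME the tree's `Literature.Analysis.FluidPDE.landauAxisField`
(Šverák 2011 (4.7); spherical: `v_r = (2/r)((c²−1)/(c − cos θ)² − 1)`, `v_θ = −2 sin θ/(r (c − cos θ))`, no swirl); the engine's `landau` base
with `A = 2` is this field (same Cartesian formula, checked by hand against `landauAxisField`). -/
abbrev landau2 : E3 → E3 := landauAxisField (EuclideanSpace.single 2 1) 2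

/-- Its pressure, BY NAME `Literature.Analysis.FluidPDE.landauAxisPressure` (`p = 4 (c cos θ − 1)/(r² (c − cos θ)²)`; the sign the engine uses). -/
abbrev landauPressure2 : E3 → ℝ := landauAxisPressure (EuclideanSpace.single 2 1) 2

/-- The rotation generator about the `e₂`-axis, `J₃ y = e₂ × y`. -/
def J3 : E3 →L[ℝ] E3 := crossCLM (EuclideanSpace.single 2 1)

/-- The regular test point `x₁ = (3, 0, 4)` (`|x₁| = 5`, cylindrical radius 3): the point of the computation. -/
def xTest : E3 := EuclideanSpace.single 0 3 + EuclideanSpace.single 2 4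

/-- `e₃ = (0,0,1)`: used both as the AXIS VECTOR of the Landau base and as the off-vertex CENTRE `x₀ = (0,0,1)` on that axis. -/
def e3 : E3 := EuclideanSpace.single 2 1

/-- (v1.2) Axial coordinates of `x` about the line `x₀ + ℝa`: (distance to the line, signed height along `a/‖a‖`). -/
def axialCoords (x₀ a x : E3) : ℝ × ℝ :=
  (Real.sqrt (‖x - x₀‖ ^ 2 - (inner ℝ (x - x₀) a) ^ 2 / ‖a‖ ^ 2), inner ℝ (x - x₀) a / ‖a‖)

/-- (v1.2) The open SOLID TORUS about the line `x₀ + ℝa` whose meridional section is the (sup-metric) disc of radius `ε` about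
`c = (ρ₁, z₁)`; used with `ε < ρ₁`, so it misses the axis.  ROTATION-INVARIANT about the axis by construction: an analytic field on it is
`2π`-periodic in the azimuth, which is what makes the per-integer-mode count the whole story (critic V26 P1). -/
def solidTorus (x₀ a : E3) (c : ℝ × ℝ) (ε : ℝ) : Set E3 :=
  {x | dist (axialCoords x₀ a x) c < ε}

/-- The solid torus of the computation at the Landau base: axis `e₃` through the vertex `0`, section disc of radius `1` about
`(ρ₁, z₁) = (3, 4)` (it contains `xTest` and misses the axis and the vertex). -/
def landauTorus : Set E3 := solidTorus 0 e3 (3, 4) 1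

/-- (v1.3) The Hagen–Poiseuille base `V = −ρ² e₃` (`ρ² = x² + y²`), pressure `−4z` (`ν = 1`): analytic on `ℝ³`, steady NS,
axisymmetric about `e₃` with no swirl, `curl V = (−2y, 2x, 0)`. -/
def poiseuille : E3 → E3 := fun x => EuclideanSpace.single 2 (-(x 0 ^ 2 + x 1 ^ 2))

/-- Its pressure `p = −4z`. -/
def poiseuillePressure : E3 → ℝ := fun x => -4 * x 2

/-- Cylindrical radius `ρ = √(x² + y²)` about the `e₃`-axis. -/
def cylRadius (x : E3) : ℝ := Real.sqrt (x 0 ^ 2 + x 1 ^ 2)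

/-- The azimuth `φ = arctan (y/x)` — a genuine analytic coordinate on the half-space `x > 0`, which contains `ball xTest 1`. -/
def azimuth (x : E3) : ℝ := Real.arctan (x 1 / x 0)

/-- (v1.3, J♭'s explicit witness) the `φ`-LINEAR MODE at the Poiseuille base:
`δv = (φ/ρ) e_φ − (log ρ/ρ) e_ρ + (ρ²/2)(log ρ − 1) e₃ = ∇((φ² − log²ρ)/2) + (ρ²/2)(log ρ − 1) e₃` (with `δp = 0`). -/
def jordanMode : E3 → E3 := fun x =>
  EuclideanSpace.single 0 ((-(azimuth x) * x 1 - Real.log (cylRadius x) * x 0) / cylRadius x ^ 2) +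
  EuclideanSpace.single 1 ((azimuth x * x 0 - Real.log (cylRadius x) * x 1) / cylRadius x ^ 2) +
  EuclideanSpace.single 2 (cylRadius x ^ 2 / 2 * (Real.log (cylRadius x) - 1))

/-- (v1.3, K♭'s axial profile) `G_γ(ρ) = ∫₂^ρ s⁻¹ e^{−γ (log s)²} ds`, the solution of `G″ + (1 + 2γ log ρ) G′/ρ = 0` with `G′(ρ) = ρ⁻¹e^{−γ log²ρ}`
(a Gaussian integral in `log ρ`; analytic on `ρ > 0`). -/
def crossFlowAxial (γ r : ℝ) : ℝ := ∫ s in (2 : ℝ)..r, Real.exp (-(γ * Real.log s ^ 2)) / s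

/-- (v1.3, K♭'s explicit family) the SECTORIAL CROSS FLOW `u_γ = ∇Χ_γ + G_γ(ρ) e₃`, `Χ_γ = γ(φ² − (log ρ)²)`:
`u_γ = (2γ/ρ²)(φ·(−y, x, 0) − log ρ·(x, y, 0)) + G_γ(ρ) e₃`. -/
def crossFlow (γ : ℝ) : E3 → E3 := fun x =>
  EuclideanSpace.single 0 (2 * γ * (-(azimuth x) * x 1 - Real.log (cylRadius x) * x 0) / cylRadius x ^ 2) +
  EuclideanSpace.single 1 (2 * γ * (azimuth x * x 0 - Real.log (cylRadius x) * x 1) / cylRadius x ^ 2) +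
  EuclideanSpace.single 2 (crossFlowAxial γ (cylRadius x))

/-- Its pressure `p = −|u_γ|²/2 + G_γ(ρ)²/2` (the constant `c` of the class taken `0`). -/
def crossFlowPressure (γ : ℝ) : E3 → ℝ := fun x =>
  -(‖crossFlow γ x‖ ^ 2) / 2 + crossFlowAxial γ (cylRadius x) ^ 2 / 2

/-- An ADMISSIBLE AXISYMMETRIC BASE on `U`: `V, p` analytic, steady NS on `U`, `A` a rotation generator, `V` infinitesimally
`A`-equivariant about `x₀` with NO swirl, and `curl V ≢ 0` on `U` (potential flows excluded). -/
def IsAxisymmetricBaseOn (U : Set E3) (x₀ : E3) (A : E3 →L[ℝ] E3) (V : E3 → E3) (p : E3 → ℝ) : Prop :=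
  AnalyticOnNhd ℝ V U ∧ AnalyticOnNhd ℝ p U ∧ IsSteadyNSOn U V p ∧ IsSkewAxis A ∧ IsEquivariantOn U x₀ A V ∧
    (∀ x ∈ U, inner ℝ (V x) (A (x - x₀)) = 0) ∧ ∃ x ∈ U, curl V x ≠ 0

/-- INFINITESIMAL RIGIDITY of the base `V` on `U` about `(x₀, A)`: every analytic solution of the linearised steady NS system on `U`
that is unthreaded about `x₀` is a tilt of `V` about `x₀` plus an `A`-equivariant field. -/
def InfinitesimallyRigidOn (U : Set E3) (x₀ : E3) (A : E3 →L[ℝ] E3) (V : E3 → E3) : Prop :=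
  ∀ (δv : E3 → E3) (δp : E3 → ℝ), AnalyticOnNhd ℝ δv U → AnalyticOnNhd ℝ δp U →
    LinearisedSteadyNSOn U V δv δp → IsUnthreadedOn U x₀ δv → ∃ Ω : E3, IsEquivariantOn U x₀ A (δv - tilt V x₀ Ω)

/-! ## Statements -/

/-- (I♭, conjecture C — COMPUTED EVIDENCE, the card's first lemma; v1.2: RE-TYPED ON SOLID TORI, critic V26 P1) **Infinitesimal rigidity
off the centre.**  Let `V, p` be an admissible axisymmetric base (analytic steady NS, equivariant with no swirl about the axis `x₀ + ℝa`,
`curl V ≢ 0`) on the rotation-invariant solid torus `T = solidTorus x₀ a c ε` (`ε < c.1`: off the axis), NOT (−1)-homogeneous about `x₀`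
on `T`.  Then every analytic solution `(δv, δp)` on `T` of the linearised steady NS system at `V` which is unthreaded about `x₀` is a TILT
plus an equivariant field.  Why a torus: on `T` an analytic `δv` is `2π`-periodic in the azimuth, so it is the sum of its INTEGER Fourier
modes, each with meridional coefficients analytic near `c`; per mode `k ∉ {0, ±1}` the formal solution space at `c` is `0` (computed), so the
mode vanishes identically — no convergence issue (P2); `k = ±1` carries only the tilt jet, `k = 0` is equivariant by definition.  On a
BALL the statement is FALSE (`φ`-linear solutions: J♭ below).  Evidence: exact jet counts `h_k = 0` (`k = 2..8`), `h_1 = 1` at 9 generic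
bases × 3 points and at the Landau base with a non-vertex centre, stable to order 14; no Jordan chain at `k = ±1`; `h = 0` also at the
non-integer / complex mode parameters `1/2, 3/2, 7/2, i, 2i, 1+i, (1+i)/2, 2+3i` (`AzimuthalCartanResults.md`).  Why it might fail: the
degeneracy locus of the symbol could be larger than the homogeneous jets (untested special bases: with potential swirl `κ ≠ 0`, or with
`curl V = 0` at the section centre), and "formal at sampled bases to order 14" is not "at all orders for all bases".  Booking words (P5):
no construction BY ANALYTIC DEFORMATION THROUGH THE AXISYMMETRIC NO-SWIRL FAMILY off a scaling vertex — formally, linearised, at sampled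
bases.  Sources: Bryant–Chern–Gardner–Goldschmidt–Griffiths, *Exterior Differential Systems* (1991) ch. IX–X; Šverák arXiv:math/0604550;
Li–Li–Yan arXiv:1609.08197, arXiv:1704.08730; Shtern–Hussain doi:10.1017/s0022112093002873 (vertex sector, see V♯). -/
def InfinitesimalRigidityOffCentre : Prop :=
  ∀ (V : E3 → E3) (p : E3 → ℝ) (a x₀ : E3) (c : ℝ × ℝ) (ε : ℝ), 0 < ε → ε < c.1 →
    IsAxisymmetricBaseOn (solidTorus x₀ a c ε) x₀ (crossCLM a) V p →
    ¬ IsMinusOneHomogeneousOn (solidTorus x₀ a c ε) x₀ V →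
    InfinitesimallyRigidOn (solidTorus x₀ a c ε) x₀ (crossCLM a) V

/-- (I♭_ball — the v1.0/v1.1 typing, on BALLS; v1.2: **FALSE**, refuted by J♭ via `ballRigidity_refuted`; kept as the settled negative
edge.)  On a ball off the axis the azimuth is a genuine coordinate and `φ · e_φ/ρ + u₀(ρ,z)` is an analytic unthreaded solution of the
linearised system which is not a tilt plus an equivariant field (critic V26 P1, made sharp by the engine's Jordan test). -/
def InfinitesimalRigidityOffCentreBall : Prop :=
  ∀ (V : E3 → E3) (p : E3 → ℝ) (a x₀ x₁ : E3) (ρ : ℝ), 0 < ρ →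
    IsAxisymmetricBaseOn (ball x₁ ρ) x₀ (crossCLM a) V p → ¬ IsMinusOneHomogeneousOn (ball x₁ ρ) x₀ V →
    InfinitesimallyRigidOn (ball x₁ ρ) x₀ (crossCLM a) V

/-- (J♭, v1.3 — PROVABLE, S–M, fully explicit; the typed form of critic V26 P1) **The `φ`-linear mode on a ball.**  At the
Poiseuille base with centre `x₀ = 0` on its axis, on `ball xTest 1` (where `x > 0`, so the azimuth is an analytic coordinate), the explicit
field `jordanMode` with `δp = 0` is an analytic solution of the linearised steady NS system, unthreaded about `0` (its curl is
`−g′(ρ) e_φ`, `g = (ρ²/2)(log ρ − 1)`; the gradient part is curl-free), and it is NOT a tilt plus a `J₃`-equivariant field: the Lie derivative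
along the rotation kills equivariant fields, maps tilts to tilts (pure `k = 1` fields), but sends `jordanMode` to the non-zero AXISYMMETRIC
field `e_φ/ρ`.  Engine certificate `jordan_check.py` (residuals ≤ 5e-16).  (v1.2 stated this at the Landau base via Cauchy–Kovalevskaya; the
Poiseuille base makes the correction `u₀` elementary: `u₀ = −(log ρ/ρ) e_ρ + g(ρ) e₃`.) -/
def PoiseuilleJordanMode : Prop :=
  AnalyticOnNhd ℝ jordanMode (ball xTest 1) ∧ LinearisedSteadyNSOn (ball xTest 1) poiseuille jordanMode 0 ∧
    IsUnthreadedOn (ball xTest 1) 0 jordanMode ∧ ¬ ∃ Ω : E3, IsEquivariantOn (ball xTest 1) 0 J3 (jordanMode - tilt poiseuille 0 Ω)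

/-- (L′, S) the Poiseuille base facts on `ball xTest 1` about `(0, J₃)`: admissible axisymmetric base (polynomial field; `curl V (xTest) =
(0, 6, 0)`), and not (−1)-homogeneous about `0` (`DV(x)x = 2V(x) ≠ −V(x)` at `xTest`). -/
def PoiseuilleBaseFacts : Prop :=
  IsAxisymmetricBaseOn (ball xTest 1) 0 J3 poiseuille poiseuillePressure ∧ ¬ IsMinusOneHomogeneousOn (ball xTest 1) 0 poiseuille

/-- (glue, S — kernel, v1.3) **The ball version is refuted**: J♭ and the Poiseuille base facts contradict I♭_ball.  Pure logic. -/
theorem ballRigidity_refuted (hJ : PoiseuilleJordanMode) (hL : PoiseuilleBaseFacts) :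
    ¬ InfinitesimalRigidityOffCentreBall := by
  intro hI
  obtain ⟨h₁, h₂, h₃, h₄⟩ := hJ
  obtain ⟨hB, hdeg⟩ := hL
  have h0 : AnalyticOnNhd ℝ (0 : E3 → ℝ) (ball xTest 1) := analyticOnNhd_const
  exact h₄ (hI poiseuille poiseuillePressure e3 0 xTest 1 one_pos hB hdeg jordanMode 0 h₁ h0 h₂ h₃)

/-- (J♭-Landau, the v1.2 statement kept BY NAME for consumers typing against v1.2 — PROVABLE but L+ in Lean: needs Cauchy–Kovalevskaya for
the forced poloidal corrector `u₀`; the cheap route is the Poiseuille J♭ above) At the Landau base `landau2` with the off-vertex centre `e₃` on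
its axis, on some ball about `xTest`, there is an analytic unthreaded solution of the linearised system which is not a tilt plus a
`J₃`-equivariant field (`δv = φ∇φ + u₀(ρ,z)`). -/
def LandauBallJordanMode : Prop :=
  ∃ ρ : ℝ, 0 < ρ ∧ ρ ≤ 1 ∧ ∃ (δv : E3 → E3) (δp : E3 → ℝ),
    AnalyticOnNhd ℝ δv (ball xTest ρ) ∧ AnalyticOnNhd ℝ δp (ball xTest ρ) ∧
    LinearisedSteadyNSOn (ball xTest ρ) landau2 δv δp ∧ IsUnthreadedOn (ball xTest ρ) e3 δv ∧
    ¬ ∃ Ω : E3, IsEquivariantOn (ball xTest ρ) e3 J3 (δv - tilt landau2 e3 Ω)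

/-- (glue, S — kernel; = v1.2's `ballRigidity_refuted` verbatim, renamed) J♭-Landau plus the Landau base facts about the centre `e₃` on small
balls about `xTest` also refute I♭_ball.  Pure logic. -/
theorem ballRigidity_refuted_landau (hJ : LandauBallJordanMode)
    (hL : ∀ ρ : ℝ, 0 < ρ → ρ ≤ 1 → IsAxisymmetricBaseOn (ball xTest ρ) e3 J3 landau2 landauPressure2 ∧
      ¬ IsMinusOneHomogeneousOn (ball xTest ρ) e3 landau2) :
    ¬ InfinitesimalRigidityOffCentreBall := by
  intro hI
  obtain ⟨ρ, hρ, hρ1, δv, δp, h₁, h₂, h₃, h₄, h₅⟩ := hJ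
  obtain ⟨hB, hdeg⟩ := hL ρ hρ hρ1
  exact h₅ (hI landau2 landauPressure2 e3 e3 xTest ρ hρ hB hdeg δv δp h₁ h₂ h₃ h₄)

/-- (V♯, computed negative fact — typed as a statement to be PROVED by exhibiting one of the six solutions; v1.2: on the solid torus)
**Landau vertex flexibility.**  At the base `landau2` (= `landauAxisField e₃ 2`) with centre the VERTEX `x₀ = 0`, on `landauTorus` (the
rotation-invariant solid torus through `xTest`, away from the axis and the vertex), there is an
analytic solution of the linearised steady NS system, unthreaded about `0`, which is NOT a tilt plus a `J₃`-equivariant field.  Evidence: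
`h_k = 6` for `k = 1..5` (stable, orders 10 and 12, two points); `indicial.py`: the six are homogeneous, four of degree −1 and two of
degree −2 in `δv` (characteristic polynomial `μ⁴(μ+1)²` of the scaling generator, diagonalisable), so e.g. a `k = 2` degree-(−1) solution
is an explicit rational-trigonometric field times `cos 2φ` / `sin 2φ` (to be extracted from the engine's nullspace), defined on the
whole cone off the axis, hence on the torus.  Why it might fail: only if the formal solutions failed to converge — excluded here since
they are homogeneous functions determined by an ODE in the polar angle with analytic coefficients away from the axis.  NEAREST PRINT
(critic V26 P3): Shtern–Hussain, JFM 256 (1993) 535–560, doi:10.1017/s0022112093002873; JFM 366 (1998), doi:10.1017/s002211209800891x —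
per-azimuthal-wavenumber steady symmetry breaking of conically similar flows, an ODE eigenproblem in the polar angle WITH regularity on the
whole sphere (bifurcation at critical Reynolds numbers); V♯ is their setting without boundary conditions and with the unthreaded
constraint added (6 per mode: 4 of degree −1 ⊇ the 2-per-mode linearised Liouville class, 2 of degree −2). -/
def LandauVertexFlexibility : Prop :=
  ∃ (δv : E3 → E3) (δp : E3 → ℝ), AnalyticOnNhd ℝ δv landauTorus ∧ AnalyticOnNhd ℝ δp landauTorus ∧
    LinearisedSteadyNSOn landauTorus landau2 δv δp ∧ IsUnthreadedOn landauTorus 0 δv ∧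
    ¬ ∃ Ω : E3, IsEquivariantOn landauTorus 0 J3 (δv - tilt landau2 0 Ω)

/-- (L, S-sized facts about the explicit Landau flow on the test torus, routine but not proved in this sketch) `landau2, landauPressure2`
(= `landauAxisField e₃ 2`, `landauAxisPressure e₃ 2`; smoothness off the axis half-line is the tree's `contDiffOn_landauAxisField`) form an
admissible axisymmetric base on `landauTorus` about `(0, J₃)`: analytic, steady NS, `J₃`-equivariant, no swirl, `curl ≢ 0`.
[Landau 1944; Šverák arXiv:math/0604550, §2; checked symbolically in the engine: base residuals vanish identically] -/
def LandauBaseFacts : Prop :=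
  IsAxisymmetricBaseOn landauTorus 0 J3 landau2 landauPressure2

/-- (glue, S — kernel) **The non-degeneracy clause of I♭ is necessary**: infinitesimal rigidity off the centre together with the
computed vertex flexibility forces the Landau germ to be (−1)-homogeneous about its vertex on the test ball (which it is — so there is no
contradiction, only the information that I♭ without the clause is FALSE).  Pure logic (modus tollens). -/
theorem landau_vertex_is_degenerate (hI : InfinitesimalRigidityOffCentre) (hF : LandauVertexFlexibility)
    (hL : LandauBaseFacts) : IsMinusOneHomogeneousOn landauTorus 0 landau2 := by
  by_contra hdeg
  obtain ⟨δv, δp, h₁, h₂, h₃, h₄, h₅⟩ := hF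
  have h3lt : (1 : ℝ) < ((3 : ℝ), (4 : ℝ)).1 := by norm_num
  exact h₅ (hI landau2 landauPressure2 e3 0 (3, 4) 1 one_pos h3lt hL hdeg δv δp h₁ h₂ h₃ h₄)

/-- (C♭, the BALL statement — v1.3: **FALSE**, refuted by the explicit sectorial cross flows K♭ via `crossFlows_refute_ballRigidity`;
kept as the settled negative edge) **Steady local rigidity off the centre (ball version).**  An analytic steady NS flow on a ball, unthreaded
about `x₀`, with `curl ≢ 0`, not (−1)-homogeneous about `x₀`, is infinitesimally axisymmetric about an axis through `x₀` with constant swirl.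
FALSE on balls: `u_γ = ∇[γ(φ² − log²ρ)] + G_γ(ρ) e₃` (`crossFlow`).  The supported nonlinear statement is C♯ (full shells: rotation-invariant
about every axis through `x₀`, where neither `φ` nor a cut exists). -/
def SteadyLocalRigidityOffCentre : Prop :=
  ∀ (V : E3 → E3) (p : E3 → ℝ) (x₀ x₁ : E3) (ρ : ℝ), 0 < ρ →
    AnalyticOnNhd ℝ V (ball x₁ ρ) → AnalyticOnNhd ℝ p (ball x₁ ρ) → IsSteadyNSOn (ball x₁ ρ) V p →
    IsUnthreadedOn (ball x₁ ρ) x₀ V → (∃ x ∈ ball x₁ ρ, curl V x ≠ 0) → ¬ IsMinusOneHomogeneousOn (ball x₁ ρ) x₀ V →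
    ∃ A : E3 →L[ℝ] E3, IsSkewAxis A ∧ IsEquivariantOn (ball x₁ ρ) x₀ A V ∧ HasConstantSwirlOn (ball x₁ ρ) x₀ A V

/-- (C♭₀, the UNRESTRICTED version — conjecturally FALSE, see K♯) the same without the non-homogeneity clause. -/
def SteadyLocalRigidityOffCentreUnrestricted : Prop :=
  ∀ (V : E3 → E3) (p : E3 → ℝ) (x₀ x₁ : E3) (ρ : ℝ), 0 < ρ →
    AnalyticOnNhd ℝ V (ball x₁ ρ) → AnalyticOnNhd ℝ p (ball x₁ ρ) → IsSteadyNSOn (ball x₁ ρ) V p →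
    IsUnthreadedOn (ball x₁ ρ) x₀ V → (∃ x ∈ ball x₁ ρ, curl V x ≠ 0) →
    ∃ A : E3 →L[ℝ] E3, IsSkewAxis A ∧ IsEquivariantOn (ball x₁ ρ) x₀ A V ∧ HasConstantSwirlOn (ball x₁ ρ) x₀ A V

/-- (K♯ — ESSENTIALLY IN PRINT, to be typed as a Literature fact; the count re-detects it) **Poloidal conical flows.**  There is an
analytic steady NS flow on some ball, (−1)-homogeneous about a point `x₀` outside it and unthreaded about `x₀`, with `curl ≢ 0`, which is NOT
infinitesimally axisymmetric with constant swirl about any axis through `x₀` on that ball.  WITNESSES IN PRINT: Šverák's conformal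
correspondence (arXiv:math/0604550 §3–4; tree: `SverakLandauConformal`, `exists_conformal_potential`) builds a (−1)-homogeneous steady NS
flow with tangential part `∇_{S²}φ` — hence unthreaded about the vertex — from every solution of the Liouville equation
`−Δ_{S²}φ + 2 = 2e^{φ}`, i.e. from every locally univalent meromorphic `f` via `φ = log (|f′|²(1+|z|²)²/(1+|f|²)²)`; `f = az` gives Landau,
and NON-axisymmetric local examples come from e.g. `f = a e^{bz}` (survey arXiv:2509.07243 §2.1.3, p. 7: "non-axisymmetric solutions can
be constructed by choosing suitable forms of f").  The jet count sees them: at the Landau base with centre = vertex there are, per azimuthal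
mode, 4 formal solutions homogeneous of degree −1 (≥ 2 of them = the linearised Liouville class; whether the other 2 — non-constant
Bernoulli head `K` on spherical caps — integrate to exact flows is OPEN) and 2 of degree −2.  NUMERICALLY CERTIFIED (v1.1, `conformal_check.py`, order-3
automatic differentiation): for `f = e^{z}` and `f = e^{0.6z}` the flow `u = ∇Φ + (2e^{Φ} − 2)x/|x|²`, `p = (2e^{Φ} − 2)/|x|² − ½|∇Φ|²`
(`Φ(x) = φ(x/|x|)`; normalisation checked on Landau) has steady-NS residual ≤ 4e-14 against O(1) terms, `div u`, `x·curl u` ≤ 5e-15,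
`|curl u|` up to 2.75, and rotational-equivariance defect `min_{|a|=1} Σ|Du(a×x) − a×u|² = 2.01` resp. `0.81` (Landau: 1e-30): NO axis.
What typing must still do: the same four facts as Lean statements about the explicit field on a ball inside its cone of smoothness.
Sources: Šverák arXiv:math/0604550; Li–Li–Yan arXiv:1609.08197, 1704.08730, 1901.08218; survey arXiv:2509.07243 §2.1.3. -/
def PoloidalConicalFlows : Prop :=
  ∃ (V : E3 → E3) (p : E3 → ℝ) (x₀ x₁ : E3) (ρ : ℝ), 0 < ρ ∧
    AnalyticOnNhd ℝ V (ball x₁ ρ) ∧ AnalyticOnNhd ℝ p (ball x₁ ρ) ∧ IsSteadyNSOn (ball x₁ ρ) V p ∧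
    IsUnthreadedOn (ball x₁ ρ) x₀ V ∧ (∃ x ∈ ball x₁ ρ, curl V x ≠ 0) ∧ IsMinusOneHomogeneousOn (ball x₁ ρ) x₀ V ∧
    ¬ ∃ A : E3 →L[ℝ] E3, IsSkewAxis A ∧ IsEquivariantOn (ball x₁ ρ) x₀ A V ∧ HasConstantSwirlOn (ball x₁ ρ) x₀ A V

/-- (glue, S — kernel) Poloidal conical flows refute the unrestricted local rigidity statement: regularity at the centre (g5's
ball-about-`x₀` formulation) or the non-homogeneity clause (C♭) is load-bearing.  Pure logic. -/
theorem conicalFlows_refute_unrestricted (hK : PoloidalConicalFlows) : ¬ SteadyLocalRigidityOffCentreUnrestricted := by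
  intro hC
  obtain ⟨V, p, x₀, x₁, ρ, hρ, hV, hp, hNS, hU, hcurl, _hhom, hnot⟩ := hK
  exact hnot (hC V p x₀ x₁ ρ hρ hV hp hNS hU hcurl)

/-- (glue, S — kernel) Conversely the restricted statement C♭ is silent on conical flows (its clause excludes them), so K♯ and C♭ are
compatible; recorded as the trivial remark that C♭ follows from C♭₀. -/
theorem offCentre_of_unrestricted (hC : SteadyLocalRigidityOffCentreUnrestricted) : SteadyLocalRigidityOffCentre :=
  fun V p x₀ x₁ ρ hρ hV hp hNS hU hcurl _ => hC V p x₀ x₁ ρ hρ hV hp hNS hU hcurl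

/-- (K♭, v1.3 — PROVABLE, M: explicit calculus + the fundamental theorem of calculus for `G_γ`; analyticity of the primitive of an analytic
function is the only non-routine line) **Sectorial cross flows.**  For every `γ ≠ 0`, on `ball xTest 1` with centre `x₀ = 0`: `crossFlow γ`,
`crossFlowPressure γ` form an analytic steady NS flow, unthreaded about `0`, with `curl ≢ 0`, not (−1)-homogeneous about `0`, and NOT
infinitesimally axisymmetric with constant swirl about ANY axis through `0`.  Paper proof: `u = ∇Χ + G(ρ)e₃` with `Χ = γ(φ² − log²ρ)` planar
harmonic ⇒ `div u = 0`; `(u·∇)u = ∇(|u|²/2 − G²/2) + (∇Χ·∇G) e₃`, `Δu = (Δ₂G) e₃`, and `Δ₂G − ∇Χ·∇G = G″ + (1 + 2γ log ρ)G′/ρ = 0` for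
`G′ = ρ⁻¹e^{−γ log²ρ}` ⇒ NS with `p = −|u|²/2 + G²/2`; `curl u = −G′(ρ) e_φ ⊥ x`; `L_{e₃} u = 2γ e_φ/ρ ≠ 0`, and equivariance about another
axis through `0` would make the azimuthal field `curl u` invariant under all of `SO(3)`, hence `0`.  CLASS in print (potential cross flow +
axial advection–diffusion profile): Weinbaum–O'Brien 1967 doi:10.1063/1.1762303; Wang 1991 doi:10.1146/annurev.fl.23.010191.001111.  Engine
certificate: `crossflow_check.py` (`γ = 0.5, 2`). -/
def SectorialCrossFlows : Prop :=
  ∀ γ : ℝ, γ ≠ 0 →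
    AnalyticOnNhd ℝ (crossFlow γ) (ball xTest 1) ∧ AnalyticOnNhd ℝ (crossFlowPressure γ) (ball xTest 1) ∧
    IsSteadyNSOn (ball xTest 1) (crossFlow γ) (crossFlowPressure γ) ∧ IsUnthreadedOn (ball xTest 1) 0 (crossFlow γ) ∧
    (∃ x ∈ ball xTest 1, curl (crossFlow γ) x ≠ 0) ∧ ¬ IsMinusOneHomogeneousOn (ball xTest 1) 0 (crossFlow γ) ∧
    ¬ ∃ A : E3 →L[ℝ] E3, IsSkewAxis A ∧ IsEquivariantOn (ball xTest 1) 0 A (crossFlow γ) ∧ HasConstantSwirlOn (ball xTest 1) 0 A (crossFlow γ)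

/-- (K♭₁, v1.3c — the `γ = 1` instance of K♭, stated separately so a prover carries no parameter (critic V26-R2); this is all the glue
consumes.) -/
def SectorialCrossFlowOne : Prop :=
  AnalyticOnNhd ℝ (crossFlow 1) (ball xTest 1) ∧ AnalyticOnNhd ℝ (crossFlowPressure 1) (ball xTest 1) ∧
    IsSteadyNSOn (ball xTest 1) (crossFlow 1) (crossFlowPressure 1) ∧ IsUnthreadedOn (ball xTest 1) 0 (crossFlow 1) ∧
    (∃ x ∈ ball xTest 1, curl (crossFlow 1) x ≠ 0) ∧ ¬ IsMinusOneHomogeneousOn (ball xTest 1) 0 (crossFlow 1) ∧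
    ¬ ∃ A : E3 →L[ℝ] E3, IsSkewAxis A ∧ IsEquivariantOn (ball xTest 1) 0 A (crossFlow 1) ∧ HasConstantSwirlOn (ball xTest 1) 0 A (crossFlow 1)

theorem sectorialCrossFlowOne_of (hK : SectorialCrossFlows) : SectorialCrossFlowOne := hK 1 one_ne_zero

/-- (glue, S — kernel, v1.3c) the `γ = 1` instance alone refutes C♭.  Pure logic. -/
theorem crossFlowOne_refutes_ballRigidity (hK : SectorialCrossFlowOne) : ¬ SteadyLocalRigidityOffCentre := by
  intro hC
  obtain ⟨hV, hp, hNS, hU, hcurl, hhom, hnot⟩ := hK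
  exact hnot (hC (crossFlow 1) (crossFlowPressure 1) 0 xTest 1 one_pos hV hp hNS hU hcurl hhom)

/-- (glue, S — kernel, v1.3) **The nonlinear ball statement C♭ is refuted** by the sectorial cross flow with `γ = 1`.  Pure logic. -/
theorem crossFlows_refute_ballRigidity (hK : SectorialCrossFlows) : ¬ SteadyLocalRigidityOffCentre :=
  crossFlowOne_refutes_ballRigidity (sectorialCrossFlowOne_of hK)

/-- (glue, S — kernel, v1.3) … hence also the unrestricted statement C♭₀ dies a second time, by elementary witnesses. -/
theorem crossFlows_refute_unrestricted (hK : SectorialCrossFlows) : ¬ SteadyLocalRigidityOffCentreUnrestricted :=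
  fun hC => crossFlows_refute_ballRigidity hK (offCentre_of_unrestricted hC)

/-- (C♯, conjecture C — semi-local: local in the radius, global in the angles) **Steady shell rigidity.**  An analytic steady NS flow on a
full spherical shell about `x₀`, unthreaded about `x₀` there, with `curl ≢ 0`, is infinitesimally axisymmetric about an axis through `x₀`
with constant swirl on the shell (the constant is then `0`: the axis meets the shell).  No homogeneity clause: a (−1)-homogeneous flow on
a FULL shell extends to `ℝ³ ∖ {x₀}` and is Landau by Šverák's theorem.  Why it might fail: as C♭ (exotic component), now also requiring
the local symmetry axes of different patches to agree (they do for analytic flows on a connected shell: identity theorem).  Sources: as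
I♭; Šverák arXiv:math/0604550 Thm 1. -/
def SteadyShellRigidity : Prop :=
  ∀ (V : E3 → E3) (p : E3 → ℝ) (x₀ : E3) (r₁ r₂ : ℝ), 0 < r₁ → r₁ < r₂ →
    AnalyticOnNhd ℝ V (shell x₀ r₁ r₂) → AnalyticOnNhd ℝ p (shell x₀ r₁ r₂) → IsSteadyNSOn (shell x₀ r₁ r₂) V p →
    IsUnthreadedOn (shell x₀ r₁ r₂) x₀ V → (∃ x ∈ shell x₀ r₁ r₂, curl V x ≠ 0) →
    ∃ A : E3 →L[ℝ] E3, IsSkewAxis A ∧ IsEquivariantOn (shell x₀ r₁ r₂) x₀ A V ∧ HasConstantSwirlOn (shell x₀ r₁ r₂) x₀ A V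

/-- The steady stratum of 1222 in classical form — VERBATIM twin of `CentreJetSketch.SteadyUnthreadedLiouville` (crux workfile, l.356;
g5): a bounded classical steady NS flow on `ℝ³` unthreaded about a point is constant.  OPEN. -/
def SteadyUnthreadedLiouville' : Prop :=
  ∀ (V : E3 → E3) (p : E3 → ℝ) (x₀ : E3), IsSteadyNSOn univ V p → (∃ B : ℝ, ∀ x, ‖V x‖ ≤ B) →
    IsUnthreadedAbout x₀ V → ∃ b : E3, ∀ x, V x = b

/-- (R♯, reduction — OPEN, M-sized, paper-sketched) **Shell rigidity decides the steady stratum.**  Sketch: a bounded entire steady flow is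
analytic (tree: `steadyNS_analytic`-type facts used by g5's engine); if `curl V ≡ 0` use `CentreJet.irrotationalSteadyLiouville`
(kernel, p677698); else pick a shell about `x₀` containing a point with `curl ≠ 0`, get `A` from C♯, extend `A`-equivariance and the
swirl identity to `ℝ³` by the identity theorem (`SilentShells.isAxisymmetric_of_locallyAxisymmetric` pattern), read `κ = 0` on the axis,
convert the infinitesimal symmetry to a frame `g` with `rotZ`-equivariance (the one genuinely new formal step: integrate the rotation
flow), and finish with g5's engine `CentreJet.eq_const_of_local_symmetry` (KNSS 2009 Thm 5.2 [Literature fact] + `steadyClassicalIsMild`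
+ `steadyNSGradientBounds`). -/
def ShellReduction : Prop := SteadyShellRigidity → SteadyUnthreadedLiouville'

/-- (glue, S — kernel; v1.2) the chain, by modus ponens: shell rigidity (C♯, conjecture; I♭ on tori is its linearised evidence, a shell
being a union of solid tori about any axis through `x₀`) and the reduction R♯ give the steady stratum of 1222.  (v1.0's detour through the
ball statement C♭ and `LocalToShell` is dropped: C♭ is demoted, see its docstring.) -/
theorem steadyStratum_of_shell (hR : ShellReduction) (hC : SteadyShellRigidity) : SteadyUnthreadedLiouville' :=
  hR hC

end Summit.NavierStokesRegularity.NavierStokesRegularity.Cruxes.PoloidalLiouville.AzimuthalCartan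

end
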